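import Summits.ResolutionOfSingularities.ResolutionOfSingularities.Theorems.PicoverLocalModel.Negative.LoadBearing
import Summits.ResolutionOfSingularities.ResolutionOfSingularities.Theorems.PicoverLocalModel.Negative.FiniteTypeLoadBearing
import Summits.ResolutionOfSingularities.ResolutionOfSingularities.Theorems.PicoverLocalModel.Negative.WeakResolutionFiniteNormalization

/-!
# Disproof of `PicoverLocalModel` (crux stmt-ResolutionOfSingularities-0557) — findings

Standing adversary work file (cdisprove, gen 1, cycle 1, **v1.1b** 2026-08-16,
refuter-cdisprove-stmt-ResolutionOfSingularities-0557-0). Every theorem is sorry-free; the proofs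
live in the five LANDED negative-lemma modules (the first three imported above; `FiniteTypeUnconditional`
and `PowerDichotomy` are referenced by name only until the check farm has built them) (namespace
`Summit.ResolutionOfSingularities.ResolutionOfSingularities.Theorems.PicoverLocalModel.Negative`,
abbreviated `Neg.` below):

* `Negative/LoadBearing.lean` (p90334, commit 9842de1dfaf2) — §0–§3, §5;
* `Negative/FiniteTypeLoadBearing.lean` (p90337, commit 00610f2aa8bb) — §4 modulo the link `hL`;
* `Negative/WeakResolutionFiniteNormalization.lean` (p91162, commit 9652470c9eb8) — THE LINK PROVED
  (`Neg.finite_of_hasResolution`; v1.0's NEAR-MISS §6 is closed);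
* `Negative/FiniteTypeUnconditional.lean` (p91748, commit 43b30c00bb23) — §4 unconditional;
* `Negative/PowerDichotomy.lean` (p91981, commit 462d1dbff6e4) — §2′: the `p`-th-power dichotomy (`crux_iff_nonpower`).

This file is the INDEX: it restates each finding as a one-line theorem whose proof is the landed
declaration, so that ideators / planners / leads can `#check` the exact shapes.

THE CRUX (route `pAlteration`, rank 5; Lean `PicoverLocalModel`): for every prime `p`, field `k`
of characteristic `p`, regular finitely generated `k`-domain `R` and `a ∈ R`, the affine scheme
`Spec (R[T]/(T^p - a))_red = Spec (AdjoinRoot (X^p - C a) ⧸ nilradical _)` has a resolution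
(`Scheme.HasResolution`, weak form). Elaboration: clean (universe 0, no junk operators;
`⧸ nilradical` restores reducedness; `R → model` injective and integral, so the model has the
dimension of `R`, `Neg.ringKrullDim_localModelRing`).

FINDINGS.
* §1 WEB. summit ⇒ crux (`Neg.localModel_of_resolutionInChar`, `not_summit_of_not_crux` below): a
  kill of this crux is a counterexample to resolution of singularities in characteristic `p`; none
  is known or conjectured. Modulo the named fact `CossartPiltant2019` the crux HOLDS for
  `dim R ≤ 3` (`crux_of_dim_le_three`); the open case is exactly `dim R ≥ 4`
  (`Literature.Barriers.ResolutionOfSingularities.DimensionFourFrontier`), where the class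
  `t^p = a` hosts the hardest known phenomena (kangaroo points, Hauser–Perlega cycles:
  `…Barriers…KangarooShadeIncrease`, `…ResidualOrderUnbounded`) — obstructions to STRATEGIES
  (invariant drop), not to EXISTENCE.
* §2 LOAD-BEARING: `⧸ nilradical` — FALSE without it at every prime (`k = R = 𝔽_p`, `a = 0`: one
  non-reduced point; `crux_false_without_red`). §2′ BUT COSMETIC: by the `p`-th-power dichotomy
  (`R` regular ⇒ normal; `a = b^p` ⇒ model `= Spec R`; `a ∉ R^p` ⇒ `R[T]/(T^p - a)` is already an
  integral domain, `Neg.isDomain_adjoinRoot_of_not_pow`) the crux is EQUIVALENT to its honest form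
  "`∀ a ∉ R^p`, `Spec R[T]/(T^p - a)` has a resolution" with no reduction (`crux_iff_nonpower`).
* §3 LOAD-BEARING (strong sense): `IsRegularRing R` — at `a = 0` the model IS `Spec R`
  (`Neg.hasResolution_localModel_zero_iff`), so the crux without regularity contains resolution of
  every integral affine finite-type `k`-scheme (`affine_summit_of_crux_without_regular`) and the
  summit gives it back (`Neg.picoverLocalModel_without_regular_of_summit`).
* §4 LOAD-BEARING, UNCONDITIONALLY: `Algebra.FiniteType k R` (excellence) — FALSE without it at
  every prime at F. K. Schmidt's DVR `S = K ∩ 𝔽_p⟦X⟧`, `K = 𝔽_p(X, f^p)`, `a = f^p`: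
  `S[T]/(T^p - a) ≅ S[f]` is a one-dimensional Noetherian local domain with NON-finite
  normalization (Kollár 2007 Claim 1.104, in tree), and such a spectrum has no weak resolution by
  the link (`crux_false_without_finiteType`).
* THE LINK (`Neg.finite_of_hasResolution`, restated as `link` below): `B` a domain, `W` a valuation
  ring of `Frac B` containing `B` and integral over it; a weak resolution of `Spec B` makes `W` a
  finite `B`-module (valuative criterion ⇒ centre `x'`; `𝒪_{X',x'} → W` injective by birationality,
  onto by normality of the regular local ring; `𝒪_{X',x'}` essentially of finite type ⇒ `W`
  finite). Also shows Nagata's / Schmidt's one-dimensional rings have no resolution even in the weak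
  sense (sharpens `QuasiExcellenceNecessary`, scope caveat (c)).
* §5 DEGENERATE INSTANCES DO NOT BITE: `a = 0` (`Neg.localModel_zero`), hypotheses jointly
  satisfiable with true conclusion (`Neg.picoverLocalModel_hypotheses_satisfiable`); `a = b^p` is
  the same collapse after `T ↦ T + b`; `R` a field gives the spectrum of a field.
* NOT FORMALISED (paper): `IsDomain R` is not load-bearing (regular Noetherian ring = finite
  product of regular domains; model of a product = disjoint union); `CharP k p` / `p.Prime` only
  tie `p` to `char k` (at `p = 0` the statement is Hironaka; composite characteristic is empty);
  strengthening "the model itself is regular" is FALSE over a curve (`t² = x³` over `𝔽₂[x]`, the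
  cusp — cf. `…Theorems.WeightedThesis.Negative.not_isRegular_spec_cusp`); "the normalization of
  the model is regular" holds for `dim R = 1` and FAILS from `dim R = 2` (`t² = xy`); dropping `k`
  but keeping `R` EXCELLENT regular is the general excellent case (open, expected true).
* Targets: none yet (payload `stuck_stubs = []`).

BARRIER CATALOGUE versus this crux: `DimensionFourFrontier` APPLIES (open from `dim R = 4`, no
evasion claimed by the route); `QuasiExcellenceNecessary` is exactly §4's mechanism (the crux keeps
finite type, so it evades it — and this work file proves the weak-resolution form of that barrier
for Schmidt's ring); `InseparableBaseChange(Resolution)` does not bite (absolute `HasResolution`, no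
base change); `KangarooShadeIncrease` / `ResidualOrderUnbounded` / `NarasimhanMaximalContact` /
`DirectrixSmallCharacteristic` obstruct invariant-based STRATEGIES on exactly this hypersurface
class but say nothing against existence.

WHY IT RESISTS. The statement is a faithful special case of the resolution conjecture in positive
characteristic (reduced, affine, finite type over a field ⇒ excellent), known in dimension ≤ 3 and
with no candidate counterexample in any dimension; every cheap attack either hits a genuinely
load-bearing hypothesis (§2–§4, each of which the statement HAS) or a degenerate instance where
the conclusion is true (§5). A refutation would refute the summit.
-/

noncomputable section

open CategoryTheory AlgebraicGeometry Polynomial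
open Literature.AlgebraicGeometry.Resolution
open Summit.ResolutionOfSingularities.ResolutionOfSingularities.Theses.PAlteration
open Summit.ResolutionOfSingularities.ResolutionOfSingularities.Theorems.PicoverLocalModel

set_option linter.dupNamespace false

namespace Summit.ResolutionOfSingularities.ResolutionOfSingularities.Cruxes.PicoverLocalModel.Disproof

/-! ## §0 The crux, per prime -/

/-- The coordinate ring of the local model, `(R[T]/(T^p - a))_red`. -/
abbrev LocalModelRing (p : ℕ) {R : Type} [CommRing R] (a : R) : Type :=
  AdjoinRoot ((X : R[X]) ^ p - C a) ⧸ nilradical (AdjoinRoot ((X : R[X]) ^ p - C a))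

/-- The crux at one exponent `p`. -/
def LocalModelAt (p : ℕ) : Prop :=
  ∀ (k : Type) [Field k] [CharP k p] (R : Type) [CommRing R] [IsDomain R] [Algebra k R],
    Algebra.FiniteType k R → IsRegularRing R → ∀ a : R,
      Scheme.HasResolution (Spec (.of (LocalModelRing p a)))

/-- The crux is the conjunction over primes of `LocalModelAt`. [folklore] -/
theorem crux_iff : PicoverLocalModel ↔ ∀ p : ℕ, p.Prime → LocalModelAt p := Iff.rfl

/-! ## §1 Web -/

/-- summit ⇒ crux. [folklore] -/
theorem crux_of_summit (h : _root_.ResolutionOfSingularities) : PicoverLocalModel :=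
  fun p hp k _ _ R _ _ _ hft _ a => Negative.localModel_of_resolutionInChar p (h p hp) k R hft a

/-- A kill of the crux kills the summit. [folklore] -/
theorem not_summit_of_not_crux (h : ¬ PicoverLocalModel) : ¬ _root_.ResolutionOfSingularities :=
  Negative.not_summit_of_not_picoverLocalModel h

/-- Modulo `CossartPiltant2019` the crux holds whenever `dim R ≤ 3`.
[cite: CossartPiltant2019, Thm. 1.1] -/
theorem crux_of_dim_le_three (hCP : CossartPiltant2019.{0}) (p : ℕ) (hp : p.Prime) (k : Type)
    [Field k] [CharP k p] (R : Type) [CommRing R] [IsDomain R] [Algebra k R]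
    (hft : Algebra.FiniteType k R) (hdim : ringKrullDim R ≤ 3) (a : R) :
    Scheme.HasResolution (Spec (.of (LocalModelRing p a))) :=
  Negative.localModel_of_dim_le_three hCP p hp k R hft hdim a

/-! ## §2–§4 Load-bearing hypotheses -/

/-- The crux with the reduction `⧸ nilradical` dropped. -/
def PicoverLocalModelWithoutRed : Prop :=
  ∀ p : ℕ, p.Prime → ∀ (k : Type) [Field k] [CharP k p] (R : Type) [CommRing R] [IsDomain R]
    [Algebra k R], Algebra.FiniteType k R → IsRegularRing R → ∀ a : R,
      Scheme.HasResolution (Spec (.of (AdjoinRoot ((X : R[X]) ^ p - C a))))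

/-- **FALSE**: `k = R = 𝔽₂`, `a = 0`. [folklore] -/
theorem crux_false_without_red : ¬ PicoverLocalModelWithoutRed :=
  Negative.picoverLocalModel_false_without_red

/- §2′ (landed, `Negative/PowerDichotomy.lean`, p91981): `Neg.picoverLocalModel_iff_nonpower :
   PicoverLocalModel ↔ ∀ p prime k R (regular f.g. domain) a, (∀ b, b ^ p ≠ a) →
     HasResolution (Spec (AdjoinRoot (X ^ p - C a)))` — restated here as a theorem in v1.2. -/

/-- The crux with `IsRegularRing R` dropped. -/
def PicoverLocalModelWithoutRegular : Prop :=
  ∀ p : ℕ, p.Prime → ∀ (k : Type) [Field k] [CharP k p] (R : Type) [CommRing R] [IsDomain R]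
    [Algebra k R], Algebra.FiniteType k R → ∀ a : R,
      Scheme.HasResolution (Spec (.of (LocalModelRing p a)))

/-- … contains the affine integral summit (take `a = 0`). [folklore] -/
theorem affine_summit_of_crux_without_regular (h : PicoverLocalModelWithoutRegular) (p : ℕ)
    (hp : p.Prime) (k : Type) [Field k] [CharP k p] (R : Type) [CommRing R] [IsDomain R]
    [Algebra k R] (hR : Algebra.FiniteType k R) : Scheme.HasResolution (Spec (.of R)) :=
  Negative.affineRes_of_picoverLocalModel_without_regular h p hp k R hR

/-- … and follows from the summit. [folklore] -/
theorem crux_without_regular_of_summit (h : _root_.ResolutionOfSingularities) :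
    PicoverLocalModelWithoutRegular :=
  Negative.picoverLocalModel_without_regular_of_summit h

/-- The crux with `Algebra.FiniteType k R` dropped. -/
def PicoverLocalModelWithoutFiniteType : Prop :=
  ∀ p : ℕ, p.Prime → ∀ (k : Type) [Field k] [CharP k p] (R : Type) [CommRing R] [IsDomain R]
    [Algebra k R], IsRegularRing R → ∀ a : R,
      Scheme.HasResolution (Spec (.of (LocalModelRing p a)))

/-- **FALSE** granted the link `hL` (Schmidt's DVR, `a = f^p`); the link IS proved (`link` below),
and the sorry-free unconditional statement is LANDED as
`Neg.picoverLocalModel_false_without_finiteType'` (`Negative/FiniteTypeUnconditional.lean`, p91748)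
— restated here verbatim in v1.2 once the check farm has built that module.
[cite: Kollar2007, Example 1.103 and Claim 1.104] -/
theorem crux_false_without_finiteType
    (hL : ∀ (B : Type) [CommRing B] [IsDomain B] [IsNoetherianRing B] [IsLocalRing B],
      ringKrullDim B = 1 → Scheme.HasResolution (Spec (.of B)) →
        Module.Finite B (integralClosure B (FractionRing B))) :
    ¬ PicoverLocalModelWithoutFiniteType :=
  Negative.picoverLocalModel_false_without_finiteType hL

/-- THE LINK (v1.0's near-miss, now proved): a weak resolution of `Spec B` forces the
valuation-ring normalization `W` of the domain `B` to be finite. [folklore] -/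
theorem link {B F : Type} [CommRing B] [IsDomain B] [Field F] [Algebra B F] [IsFractionRing B F]
    (W : ValuationSubring F) [Algebra B W] [IsScalarTower B W F] [Algebra.IsIntegral B W]
    (hres : Scheme.HasResolution (Spec (.of B))) : Module.Finite B W :=
  Negative.finite_of_hasResolution W hres

/-! ## §5 Degenerate instances -/

/-- Non-vacuity at every prime (`k = R = 𝔽_p`, `a = 0`). [folklore] -/
theorem hypotheses_satisfiable (p : ℕ) [Fact p.Prime] :
    ∃ (k : Type) (_ : Field k) (_ : CharP k p) (R : Type) (_ : CommRing R) (_ : IsDomain R)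
      (_ : Algebra k R) (a : R), Algebra.FiniteType k R ∧ IsRegularRing R ∧
        Scheme.HasResolution (Spec (.of (LocalModelRing p a))) :=
  Negative.picoverLocalModel_hypotheses_satisfiable p

end Summit.ResolutionOfSingularities.ResolutionOfSingularities.Cruxes.PicoverLocalModel.Disproof

end
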